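/-
Copyright (c) 2026 the pub-hodgecm-mathlib formalisation cell (harness21).  Prover seat hodgecm-mathlib-LH4-p11 (g11), req620 Track A «(D-RAM) FOUR-FRAME» squad
(STAGE-1b, row (2) of the piece `f_{T₊}`, the (β₂) road (R-36), the K6 road; K6 desk LH4-p16 (g3) WORD #16 (P1) «WINDOW = INSIDE + TOP» — the last arithmetic joint of
the `core_holds` assembly: the inside window (★ HEAD₃ ∕ HEAD₀ of `…CoreOfPerCellLaws`) plus the top cell), 2026-09-05.
-/
import Summits.HodgeConjecture.HodgeConjecture.Theorems.F0P3cDyRamCoreOfPerCellLaws   -- ★ p864340 ∕ p864409 ∕ p864591 (LH4-p16 (g3)): the K6-(e) spine `coreWindow_of_perCellLaws`, HEAD₂, HEAD₃, HEAD₀ `coreWindow_of_cellSums`; brings ★ DEFS `levelSetDep`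
import HarnessLib

/-!
# Crux `H413`, line LH4 «(D-RAM) FOUR-FRAME» — STAGE-1b, row (2), the (β₂) road (R-36), K6-(e) assembly: «WINDOW = INSIDE + TOP» — the CORE window identity over the cells
# `0 … N` is the identity over the INSIDE cells `0 … N − 1` plus the TOP cell's value (`X_H(N) = X_A(N)` when the top cell is within the A-window `N < d`, `X_H(N) = 0` beyond it)

Cell `hodgecm-mathlib` (D-0151), FLOOR 0, crux item H413 = `stmt-HodgeConjecture-24833`, route of record `HCCMUnconditional`; squad F0∕P3c∕LH4; lane
`--supports stmt-HodgeConjecture-24833 --as helper` (count-neutral; pays NO tier-0 row).  THEOREMS ONLY (no `def`, no instance, no notation, no `sorry`, default heartbeats);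
★-only imports; states NO law; (β₂) stays a HYPOTHESIS.  Pure `Finset`∕`ℤ` arithmetic (§1) and its twin in the spine's letter currency (§2).

WHAT (K6 desk LH4-p16 (g3) WORD #16 (P1)).  The payer `core_holds (N) … : ‹CORE.letter.v1›[N]` (K6 DESK WORD #15 (d)) assembles the window `IH := Finset.range (N + 1)`,
`IA := Finset.range (min (N + 1) d)` from TWO charts: the INSIDE cells `i < N` in the inside chart (★ HEAD₃ `coreWindow_of_cellValues_sphere` ∕ HEAD₀ `coreWindow_of_cellSums` at
`IH := Finset.range N`, `IA := Finset.range (min N d)` — `hin`), and the TOP cell `i = N` in the top chart (LH4-p12's F1b-top ×2 + LH4-p15's (g-top): `X_H(N) = X_A(N)` when `N < d`,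
`X_H(N) = 0` when `d ≤ N` — the far top sphere carries no A-digit and its H-label sum vanishes — `htop`).  THIS FILE is the joint:
* §1 `sum_window_of_inside_top (XH XA : ℕ → ℤ) (N d) (hin : Σ_{i<N} XH i = Σ_{i<min N d} XA i) (htop : XH N = if N < d then XA N else 0) : Σ_{i<N+1} XH i = Σ_{i<min (N+1) d} XA i`
  (`Finset.sum_range_succ`; `N < d`: `min (N+1) d = min N d + 1 = N + 1`; `d ≤ N`: both minima are `d`, the top H-value is `0`).
* §2 `coreWindow_of_insideWindow_and_topCell` — §1 at the spine's cell values `X_t(i) = Σᶠ_{cell(b+2i,b) ∩ P_t} f_t − Σᶠ_{cell(b+2i,b) ∩ Q_t} f_t` (★ HEAD₀'s bytes VERBATIM):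
  `hin` = HEAD₀'s CONCLUSION at `(Finset.range N, Finset.range (min N d))`, `htop` = the top cell's value ⟹ HEAD₀'s conclusion at `(Finset.range (N + 1), Finset.range (min (N + 1) d))`.
WHAT IS NOT CLAIMED: `hin` (the spine + K6-0 + (f′) + (d′)(d″) + K6-(g)), `htop` (F1b-top + (g-top)), any census identity.
HONEST LABEL.  Arithmetic only; nothing printed is asserted; ‹CORE›∕‹CORE-ODD›, β₂ stay HYPOTHESES; `HC_CM` is proved only modulo the 7 printed citations (2 remaining named inputs:
hLiu418 = `stmt-HodgeConjecture-24832`, h413 = `stmt-HodgeConjecture-24833`) until rung 0 closes.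
## References
* [Kottwitz1986BaseChangeUnits] R. E. Kottwitz, *Base change for unit elements of Hecke algebras*, Compositio Math. 60 (1986): §1 pp. 240–241 (cell-by-cell lattice bookkeeping).
* [LabesseLanglands1979] J.-P. Labesse, R. P. Langlands, *L-indistinguishability for SL(2)*, Canad. J. Math. 31 (1979): §2 (2.2) p. 9 (κ-signed counts).
* [Rogawski1990] J. D. Rogawski, *Automorphic Representations of Unitary Groups in Three Variables*, Ann. of Math. Stud. 123 (1990): §4.9 Prop. 4.9.1 (b) p. 55 (the labelled census).
-/

set_option autoImplicit false

noncomputable section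

namespace Summit.HodgeConjecture.HodgeConjecture.Cruxes.H413.F0P3cDyRamCoreWindowInsideTop

open scoped Valued WithZero
open Finset
open Summit.HodgeConjecture.HodgeConjecture.Cruxes.H413.F0P3cDyRamToricCensusDefs

/-! ## §1 The arithmetic joint -/

/-- **«WINDOW = INSIDE + TOP» (pure arithmetic).**  Two cell-value families `XH XA : ℕ → ℤ`, a window height `N` and the A-window cut `d`: if the INSIDE windows agree,
`Σ_{i<N} XH i = Σ_{i<min N d} XA i`, and the TOP cell satisfies `XH N = XA N` when `N < d` (the top cell is inside the A-window) resp. `XH N = 0` when `d ≤ N` (beyond it), then the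
FULL windows agree: `Σ_{i<N+1} XH i = Σ_{i<min (N+1) d} XA i`. [cite: Kottwitz1986BaseChangeUnits, §1 pp. 240–241] -/
theorem sum_window_of_inside_top (XH XA : ℕ → ℤ) (N d : ℕ)
    (hin : ∑ i ∈ Finset.range N, XH i = ∑ i ∈ Finset.range (min N d), XA i)
    (htop : XH N = if N < d then XA N else 0) :
    ∑ i ∈ Finset.range (N + 1), XH i = ∑ i ∈ Finset.range (min (N + 1) d), XA i := by
  rw [sum_range_succ, hin, htop]
  by_cases hNd : N < d
  · rw [if_pos hNd, show min (N + 1) d = min N d + 1 by omega, sum_range_succ, show min N d = N by omega]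
  · rw [if_neg hNd, add_zero, show min (N + 1) d = min N d by omega]

/-! ## §2 The joint in the spine's letter currency -/

/-- **«WINDOW = INSIDE + TOP», LETTER CURRENCY (K6 DESK WORD #16 (P1)).**  ★ HEAD₀ `…CoreOfPerCellLaws.coreWindow_of_cellSums`' cell values
`X_t(i) := Σᶠ_{levelSetDep ρ Θ α ϖE h_t (b+2i) b μ ∩ P_t} f_t b (b+2i) − Σᶠ_{… ∩ Q_t} f_t b (b+2i)` (bytes VERBATIM); `hin` = HEAD₀'s CONCLUSION at the INSIDE windows
`(Finset.range N, Finset.range (min N d))`; `htop` = the TOP cell's value (`X_H(N) = X_A(N)` if `N < d`, `X_H(N) = 0` if `d ≤ N`).  THEN HEAD₀'s conclusion at the FULL windows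
`(Finset.range (N + 1), Finset.range (min (N + 1) d))` — ‹CORE.letter.v1›'s window shape `range ((jl − m)∕2 + 1)` ∕ `range (min ((jl − m)∕2 + 1) d)` at `N := (jl − m)∕2`.
[cite: Kottwitz1986BaseChangeUnits, §1 pp. 240–241] [cite: LabesseLanglands1979, §2 (2.2) p. 9] [cite: Rogawski1990, §4.9 Prop. 4.9.1 (b) p. 55] -/
theorem coreWindow_of_insideWindow_and_topCell {M : Type*} [Field M] [Valued M ℤᵐ⁰]
    (ρ Θ : M →+* M) (α ϖE h h' μ : M) (f f' : ℕ → ℕ → AddSubgroup M → ℕ) (b : ℕ) (PH QH PA QA : Set (AddSubgroup M)) (N d : ℕ)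
    (hin : ∑ i ∈ Finset.range N,
        (((∑ᶠ Λ ∈ levelSetDep ρ Θ α ϖE h (b + 2 * i) b μ ∩ PH, f b (b + 2 * i) Λ : ℕ) : ℤ) -
          ((∑ᶠ Λ ∈ levelSetDep ρ Θ α ϖE h (b + 2 * i) b μ ∩ QH, f b (b + 2 * i) Λ : ℕ) : ℤ)) =
      ∑ i ∈ Finset.range (min N d),
        (((∑ᶠ Λ ∈ levelSetDep ρ Θ α ϖE h' (b + 2 * i) b μ ∩ PA, f' b (b + 2 * i) Λ : ℕ) : ℤ) -
          ((∑ᶠ Λ ∈ levelSetDep ρ Θ α ϖE h' (b + 2 * i) b μ ∩ QA, f' b (b + 2 * i) Λ : ℕ) : ℤ)))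
    (htop : (((∑ᶠ Λ ∈ levelSetDep ρ Θ α ϖE h (b + 2 * N) b μ ∩ PH, f b (b + 2 * N) Λ : ℕ) : ℤ) -
          ((∑ᶠ Λ ∈ levelSetDep ρ Θ α ϖE h (b + 2 * N) b μ ∩ QH, f b (b + 2 * N) Λ : ℕ) : ℤ)) =
      if N < d then
        (((∑ᶠ Λ ∈ levelSetDep ρ Θ α ϖE h' (b + 2 * N) b μ ∩ PA, f' b (b + 2 * N) Λ : ℕ) : ℤ) -
          ((∑ᶠ Λ ∈ levelSetDep ρ Θ α ϖE h' (b + 2 * N) b μ ∩ QA, f' b (b + 2 * N) Λ : ℕ) : ℤ))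
      else 0) :
    ∑ i ∈ Finset.range (N + 1),
        (((∑ᶠ Λ ∈ levelSetDep ρ Θ α ϖE h (b + 2 * i) b μ ∩ PH, f b (b + 2 * i) Λ : ℕ) : ℤ) -
          ((∑ᶠ Λ ∈ levelSetDep ρ Θ α ϖE h (b + 2 * i) b μ ∩ QH, f b (b + 2 * i) Λ : ℕ) : ℤ)) =
      ∑ i ∈ Finset.range (min (N + 1) d),
        (((∑ᶠ Λ ∈ levelSetDep ρ Θ α ϖE h' (b + 2 * i) b μ ∩ PA, f' b (b + 2 * i) Λ : ℕ) : ℤ) -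
          ((∑ᶠ Λ ∈ levelSetDep ρ Θ α ϖE h' (b + 2 * i) b μ ∩ QA, f' b (b + 2 * i) Λ : ℕ) : ℤ)) :=
  sum_window_of_inside_top
    (fun i => ((∑ᶠ Λ ∈ levelSetDep ρ Θ α ϖE h (b + 2 * i) b μ ∩ PH, f b (b + 2 * i) Λ : ℕ) : ℤ) -
      ((∑ᶠ Λ ∈ levelSetDep ρ Θ α ϖE h (b + 2 * i) b μ ∩ QH, f b (b + 2 * i) Λ : ℕ) : ℤ))
    (fun i => ((∑ᶠ Λ ∈ levelSetDep ρ Θ α ϖE h' (b + 2 * i) b μ ∩ PA, f' b (b + 2 * i) Λ : ℕ) : ℤ) -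
      ((∑ᶠ Λ ∈ levelSetDep ρ Θ α ϖE h' (b + 2 * i) b μ ∩ QA, f' b (b + 2 * i) Λ : ℕ) : ℤ))
    N d hin htop

/-- **THE FULL ASSEMBLY IN ONE CALL**: HEAD₀ `coreWindow_of_cellSums` on the inside windows (its letters `hXH hXA hc hs` at `IH := Finset.range N`, `IA := Finset.range (min N d)`) + the
top cell's value `htop` ⟹ the CORE conclusion at the full windows. [cite: Kottwitz1986BaseChangeUnits, §1 pp. 240–241] [cite: LabesseLanglands1979, §2 (2.2) p. 9]
[cite: Rogawski1990, §4.9 Prop. 4.9.1 (b) p. 55] -/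
theorem coreWindow_of_cellSums_and_topCell {M : Type*} [Field M] [Valued M ℤᵐ⁰]
    (ρ Θ : M →+* M) (α ϖE h h' μ : M) (f f' : ℕ → ℕ → AddSubgroup M → ℕ) (b : ℕ) (PH QH PA QA : Set (AddSubgroup M)) (N d : ℕ)
    (sH sA : ℕ → ℤ) (cH cA : ℤ)
    (hXH : ∀ i ∈ Finset.range N,
      ((∑ᶠ Λ ∈ levelSetDep ρ Θ α ϖE h (b + 2 * i) b μ ∩ PH, f b (b + 2 * i) Λ : ℕ) : ℤ) -
          ((∑ᶠ Λ ∈ levelSetDep ρ Θ α ϖE h (b + 2 * i) b μ ∩ QH, f b (b + 2 * i) Λ : ℕ) : ℤ) = cH * sH i)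
    (hXA : ∀ i ∈ Finset.range (min N d),
      ((∑ᶠ Λ ∈ levelSetDep ρ Θ α ϖE h' (b + 2 * i) b μ ∩ PA, f' b (b + 2 * i) Λ : ℕ) : ℤ) -
          ((∑ᶠ Λ ∈ levelSetDep ρ Θ α ϖE h' (b + 2 * i) b μ ∩ QA, f' b (b + 2 * i) Λ : ℕ) : ℤ) = cA * sA i)
    (hc : cA = -cH) (hs : ∑ i ∈ Finset.range N, sH i + ∑ i ∈ Finset.range (min N d), sA i = 0)
    (htop : (((∑ᶠ Λ ∈ levelSetDep ρ Θ α ϖE h (b + 2 * N) b μ ∩ PH, f b (b + 2 * N) Λ : ℕ) : ℤ) -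
          ((∑ᶠ Λ ∈ levelSetDep ρ Θ α ϖE h (b + 2 * N) b μ ∩ QH, f b (b + 2 * N) Λ : ℕ) : ℤ)) =
      if N < d then
        (((∑ᶠ Λ ∈ levelSetDep ρ Θ α ϖE h' (b + 2 * N) b μ ∩ PA, f' b (b + 2 * N) Λ : ℕ) : ℤ) -
          ((∑ᶠ Λ ∈ levelSetDep ρ Θ α ϖE h' (b + 2 * N) b μ ∩ QA, f' b (b + 2 * N) Λ : ℕ) : ℤ))
      else 0) :
    ∑ i ∈ Finset.range (N + 1),
        (((∑ᶠ Λ ∈ levelSetDep ρ Θ α ϖE h (b + 2 * i) b μ ∩ PH, f b (b + 2 * i) Λ : ℕ) : ℤ) -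
          ((∑ᶠ Λ ∈ levelSetDep ρ Θ α ϖE h (b + 2 * i) b μ ∩ QH, f b (b + 2 * i) Λ : ℕ) : ℤ)) =
      ∑ i ∈ Finset.range (min (N + 1) d),
        (((∑ᶠ Λ ∈ levelSetDep ρ Θ α ϖE h' (b + 2 * i) b μ ∩ PA, f' b (b + 2 * i) Λ : ℕ) : ℤ) -
          ((∑ᶠ Λ ∈ levelSetDep ρ Θ α ϖE h' (b + 2 * i) b μ ∩ QA, f' b (b + 2 * i) Λ : ℕ) : ℤ)) :=
  coreWindow_of_insideWindow_and_topCell ρ Θ α ϖE h h' μ f f' b PH QH PA QA N d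
    (F0P3cDyRamCoreOfPerCellLaws.coreWindow_of_cellSums ρ Θ α ϖE h h' μ f f' b PH QH PA QA (Finset.range N) (Finset.range (min N d)) sH sA cH cA hXH hXA hc hs) htop

end Summit.HodgeConjecture.HodgeConjecture.Cruxes.H413.F0P3cDyRamCoreWindowInsideTop

end
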